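import Mathlib
import Summits.Ventures.PercRepro2.LocRows
import Summits.Ventures.PercRepro2.LocRows2
import Summits.Ventures.PercRepro2.LocSym
import Summits.Ventures.PercRepro2.LocMono

/-!
# The forbidden-set form of the monotone local injection: row (LOC0-mono-Y)
(blind cell PercRepro2, night-4 g2; census 2026-08-24T04:1xZ, own code mining/night-4/g2/yset.py)

In (LOC0) the second root `h` only enters through `h ∉ H_l` on both sides.  Replacing the single
vertex `h` by a SET `Y` of forbidden vertices (`H_l ∩ Y = ∅` on both sides) gives the natural
hypothesis for a vertex-deletion induction; the census says the monotone, nested, no-release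
injection still exists: ALL `(l, o, Y)` with `Y ⊆ V ∖ {l, o}`, `1 ≤ |Y| ≤ 3` at `n = 5` (648 cases)
and `|Y| ≤ 2` at `n = 6` (9,139 cases, all 112 graphs): 0 Hall failures, for the BL-local and for
the monotone relation.  `LocMonoSet` is the statement; `locMono_of_locMonoSet` recovers row
(LOC0-mono) at `Y = {h}`.  Statements and the reduction only.
-/

namespace Summit.Ventures.PercRepro2

namespace LocRows

open Hull

variable {V : Type*} {E : Type*} [Fintype E] [DecidableEq E]

open scoped Classical

variable (ends : E → Sym2 V)

/-- The source set with a forbidden vertex set `Y`: `{H_l ∩ Y = ∅, o ∈ B_side}`. -/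
noncomputable def srcY (l o : V) (Y : Set V) : Finset (Config E) :=
  Finset.univ.filter fun ζ => Disjoint (hull ends ζ l) Y ∧ o ∈ bside ends ζ l

/-- The target set with a forbidden vertex set `Y`: `{H_l ∩ Y = ∅, o ∈ R_side}`. -/
noncomputable def tgtY (l o : V) (Y : Set V) : Finset (Config E) :=
  Finset.univ.filter fun ζ => Disjoint (hull ends ζ l) Y ∧ o ∈ rside ends ζ l

/-- **Row (LOC0-mono-Y)**: the monotone, nested, no-release local injection `srcY → tgtY` for a
forbidden vertex set `Y` in place of the single root `h`. -/
def LocMonoSet (l o : V) (Y : Set V) : Prop :=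
  ∃ f : {ζ // ζ ∈ srcY ends l o Y} → Config E, Function.Injective f ∧
    ∀ x, f x ∈ tgtY ends l o Y ∧
      LocalAtSet ends (fun ζ => cluster ends (blue ζ) l) x.1 (f x) ∧
      MonoWithin ends (cluster ends (blue x.1) l) x.1 (f x) ∧
      cluster ends (blue (f x)) l ⊆ cluster ends (blue x.1) l ∧
      cluster ends (blue x.1) l \ cluster ends (blue (f x)) l ⊆ cluster ends (f x) l

/-- At `Y = {h}` the source set is the principal source set of (LOC0). -/
lemma srcY_singleton (l h o : V) : srcY ends l o {h} = srcU ends l h {S : Set V | o ∈ S} := by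
  ext ζ
  simp only [srcY, srcU, Finset.mem_filter, Finset.mem_univ, true_and, Set.disjoint_singleton_right,
    Set.mem_setOf_eq]
  constructor
  · rintro ⟨hh, ho⟩
    exact ⟨hh, ho.1, ho.2⟩
  · rintro ⟨hh, hoB, hoR⟩
    exact ⟨hh, hoB, hoR⟩

/-- At `Y = {h}` the target set is the principal target set of (LOC0). -/
lemma tgtY_singleton (l h o : V) : tgtY ends l o {h} = tgtU ends l h {S : Set V | o ∈ S} := by
  ext ζ
  simp only [tgtY, tgtU, Finset.mem_filter, Finset.mem_univ, true_and, Set.disjoint_singleton_right,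
    Set.mem_setOf_eq]
  constructor
  · rintro ⟨hh, ho⟩
    exact ⟨hh, ho.1, ho.2⟩
  · rintro ⟨hh, hoR, hoB⟩
    exact ⟨hh, hoR, hoB⟩

/-- (LOC0-mono-Y) at `Y = {h}` is row (LOC0-mono). -/
theorem locMono_of_locMonoSet (l h o : V) (hm : LocMonoSet ends l o {h}) : LocMono ends l h o := by
  unfold LocMono
  rw [← srcY_singleton ends l h o, ← tgtY_singleton ends l h o]
  exact hm

/-- (LOC0-mono-Y) over all finite graphs, roots, targets and forbidden sets. -/
def LocMonoSet_all : Prop :=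
  ∀ (V E : Type) [Fintype V] [DecidableEq V] [Fintype E] [DecidableEq E] (ends : E → Sym2 V)
    (l o : V) (Y : Set V), l ≠ o → l ∉ Y → o ∉ Y → LocMonoSet ends l o Y

end LocRows

end Summit.Ventures.PercRepro2
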